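import Summits.QuantumFields.YangMills.Theorems.AlphaInputsT3ACv3AdaptedClassL
import HarnessLib

/-!
# `AlphaInputsT3ACv3AdaptedSelL` — STRATEGY B for 2′: the MEASURABLE ARGMIN SELECTOR of the Wilson action over the LOCALISED adapted class `𝒞_L(k, h, W)`
# (`AlphaInputsT3ACv3AdaptedClassL`) at admissible histories, minimisers by compactness, and MEMBERSHIP ⇒ THE ROWS — lane `pub-balaban3d`, seat alpha-2 (g2)

CONTENTS.  §1 ★ `AlphaInputsT3AC.exists_selector_adaptedClassT3L` (`k ≤ K`, `h` ADMISSIBLE): a measurable `f : SU(2)^{bonds_k} → SU(2)^{bonds_0}` with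
`f W ∈ argmin_{𝒞_L(k,h,W)} A` wherever a minimiser exists (`1` elsewhere), and a minimiser EXISTS whenever `𝒞_L(k,h,W) ≠ ∅` — g0's closed-class selection
(`exists_measurable_argmin_closedClass`) with `C` = the W-independent core (closed at admissible `h`, sibling), `g Ũ = (the level-`k` average PATCHED off the
cones, Ũ)` (continuous ON the core: the averages of record are continuous at the read bonds only — `continuousOn_iter_readBond`), `π W = (W, 1)`, and the closed
relation «`W` charged ⇒ (42)-top on the bonds of `Ω_k(h)` ∧ r3».  §2 membership ⇒ rows (`h68`, `hLF67`, r2, r3), verbatim as for g0's class.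
HONEST FRAMING.  Kinematics∕measurable selection only; nothing of [B10]∕[7]∕[4]'s estimates is asserted; the selected configuration is NOT claimed to be print's
(42)-minimiser; the class's non-emptiness is displayed elsewhere ((D6L)), not proved.  Count-neutral helper toward R3 2′ (items 19935∕19936); nothing about
d = 4, the continuum, or a mass gap.

References: T. Bałaban, Commun. Math. Phys. 102 (1985) 255–275 [Balaban1985UV3] ((42) p.266, (67)–(68) p.273); CMP 102 (1985) 277–309 [Balaban1985Variational]
(Thm 1 (8) p.279); C. D. Aliprantis, K. C. Border, Infinite Dimensional Analysis (2006) Thm 18.19 [AliprantisBorder2006].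
-/

set_option autoImplicit false

noncomputable section

namespace Summit.QuantumFields.YangMills.Theorems

open MeasureTheory Set Topology TopologicalSpace
open scoped Matrix Matrix.Norms.L2Operator
open Literature.MeasureTheory.RandomSets
open Literature.MathematicalPhysics.QuantumFieldTheory.Balaban1983to89
open Literature.MathematicalPhysics.QuantumFieldTheory.Balaban1983to89.B10 (pFun)
open Literature.MathematicalPhysics.QuantumFieldTheory.Balaban1983to89.T3ContinuumYM3Torus
open Literature.MathematicalPhysics.QuantumFieldTheory.Balaban1983to89.T3UnitLawDensityEML (ℰp)
open Literature.MathematicalPhysics.QuantumFieldTheory.Balaban1983to89.T3UnitScaleTilt (θBal)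
open Literature.MathematicalPhysics.QuantumFieldTheory.Balaban1983to89.B10Eq38TorusDomains (plaqsIn)
open Literature.MathematicalPhysics.QuantumFieldTheory.Balaban1983to89.B10Eq42TorusConstraint (bondsIn lam42)
open Literature.MathematicalPhysics.QuantumFieldTheory.Balaban1985CMP102.Setting
open Summit.QuantumFields.Balaban3D.Carriers
open Summit.QuantumFields.Balaban3D.Proofs.Primitives (AlphaConsts)
open Summit.QuantumFields.Balaban3D.Proofs.LiftBridge (liftCfg)
open Summit.QuantumFields.Balaban3D.Proofs.Run3SmallFactors (codeZ)
open Summit.QuantumFields.YangMills.Theorems.BalabanUVNodesN08AlphaGroupTopology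
open Summit.QuantumFields.YangMills.Theorems.BalabanUVNodesN08AlphaCompactSel (regClassC regClassC_subset_regClass)
open Summit.QuantumFields.YangMills.Theorems.LocalSmallLoop (hull subset_hull)
open B7Prop1Explicit (hol plaqWord)
open B7Prop1Local (pdevOn loK plaqHiK)
open B7Prop2Explicit (avgIter)

/-! ## §1 Minimisers and the measurable argmin selector over `𝒞_L(k, h, W)` -/

section T3

variable {F : T3Family} {𝔠 : AlphaConsts F.L (suGroupModel 2).N} {γ : ℝ} {hγ : 0 < γ} {hγ1 : γ ≤ (min 𝔠.gamma0 1) ^ 2} {K : ℕ}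

open Classical in
/-- **★ MINIMISERS AND A MEASURABLE ARGMIN SELECTOR FOR THE LOCALISED ADAPTED CLASS** (`k ≤ K`, `h` ADMISSIBLE): (i) a measurable
`f : SU(2)^{bonds_k} → SU(2)^{bonds_0}` with `f W ∈ argmin_{𝒞_L(k,h,W)} A` (Wilson action) wherever a minimiser exists and `f W = 1` elsewhere; (ii) a minimiser
EXISTS as soon as `𝒞_L(k, h, W) ≠ ∅`.  g0's closed-class selection with `C` = the W-independent core, `g Ũ = ((blockAvg ℰp)^k Ũ patched to 1 off the level-k cone, Ũ)`,
`π W = (W, 1)` and the closed relation «`W` charged ⇒ top constraint on the bonds of `Ω_k(h)` ∧ r3».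
[cite: Balaban1985Variational, Thm 1 (8) p.279 (existence half by compactness; measurable-selection reading)] -/
theorem AlphaInputsT3AC.exists_selector_adaptedClassT3L {k : ℕ} (hk : k ≤ K) {h : Hist (F.P K) k}
    (hh : Hist.Admissible 𝔠.lane.carrier.M₁ (rcolOf (T3Scales F γ hγ (hγ1.trans (sq_min_one_le _ 𝔠.gamma0_pos)) K) 𝔠.lane.carrier) k h) :
    (∃ f : GaugeField (F.P K) k (Matrix.specialUnitaryGroup (Fin 2) ℂ) → GaugeField (F.P K) 0 (Matrix.specialUnitaryGroup (Fin 2) ℂ),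
      Measurable f ∧
      (∀ W, (∃ U ∈ AlphaInputsT3AC.adaptedClassT3L F 𝔠 γ hγ hγ1 K k h W,
          IsMinOn (fun U : GaugeField (F.P K) 0 (Matrix.specialUnitaryGroup (Fin 2) ℂ) => wilsonAction4 U)
            (AlphaInputsT3AC.adaptedClassT3L F 𝔠 γ hγ hγ1 K k h W) U) →
        f W ∈ AlphaInputsT3AC.adaptedClassT3L F 𝔠 γ hγ hγ1 K k h W ∧
          IsMinOn (fun U : GaugeField (F.P K) 0 (Matrix.specialUnitaryGroup (Fin 2) ℂ) => wilsonAction4 U)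
            (AlphaInputsT3AC.adaptedClassT3L F 𝔠 γ hγ hγ1 K k h W) (f W)) ∧
      (∀ W, ¬ (∃ U ∈ AlphaInputsT3AC.adaptedClassT3L F 𝔠 γ hγ hγ1 K k h W,
          IsMinOn (fun U : GaugeField (F.P K) 0 (Matrix.specialUnitaryGroup (Fin 2) ℂ) => wilsonAction4 U)
            (AlphaInputsT3AC.adaptedClassT3L F 𝔠 γ hγ hγ1 K k h W) U) → f W = 1)) ∧
    (∀ W, (AlphaInputsT3AC.adaptedClassT3L F 𝔠 γ hγ hγ1 K k h W).Nonempty →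
      ∃ U ∈ AlphaInputsT3AC.adaptedClassT3L F 𝔠 γ hγ hγ1 K k h W,
        IsMinOn (fun U : GaugeField (F.P K) 0 (Matrix.specialUnitaryGroup (Fin 2) ℂ) => wilsonAction4 U)
          (AlphaInputsT3AC.adaptedClassT3L F 𝔠 γ hγ hγ1 K k h W) U) := by
  haveI : CompactSpace (GaugeField (F.P K) 0 (Matrix.specialUnitaryGroup (Fin 2) ℂ)) :=
    inferInstanceAs (CompactSpace (PBond (F.P K) 0 → Matrix.specialUnitaryGroup (Fin 2) ℂ))
  haveI : PolishSpace (Matrix.specialUnitaryGroup (Fin 2) ℂ) := polishSpace_rho (suGroupModel 2)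
  haveI : PolishSpace (GaugeField (F.P K) 0 (Matrix.specialUnitaryGroup (Fin 2) ℂ)) :=
    inferInstanceAs (PolishSpace (PBond (F.P K) 0 → Matrix.specialUnitaryGroup (Fin 2) ℂ))
  haveI : SecondCountableTopology (GaugeField (F.P K) 0 (Matrix.specialUnitaryGroup (Fin 2) ℂ)) :=
    inferInstanceAs (SecondCountableTopology (PBond (F.P K) 0 → Matrix.specialUnitaryGroup (Fin 2) ℂ))
  haveI : BorelSpace (GaugeField (F.P K) 0 (Matrix.specialUnitaryGroup (Fin 2) ℂ)) :=
    inferInstanceAs (BorelSpace (PBond (F.P K) 0 → Matrix.specialUnitaryGroup (Fin 2) ℂ))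
  haveI : SecondCountableTopology (GaugeField (F.P K) k (Matrix.specialUnitaryGroup (Fin 2) ℂ)) :=
    inferInstanceAs (SecondCountableTopology (PBond (F.P K) k → Matrix.specialUnitaryGroup (Fin 2) ℂ))
  haveI : BorelSpace (GaugeField (F.P K) k (Matrix.specialUnitaryGroup (Fin 2) ℂ)) :=
    inferInstanceAs (BorelSpace (PBond (F.P K) k → Matrix.specialUnitaryGroup (Fin 2) ℂ))
  -- the data of the closed-class selection
  let C : Set (GaugeField (F.P K) 0 (Matrix.specialUnitaryGroup (Fin 2) ℂ)) :=
    AlphaInputsT3AC.localSmallT3 F 𝔠 γ hγ hγ1 K k h ∩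
      (regClassC (S := T3Scales F γ hγ (hγ1.trans (sq_min_one_le _ 𝔠.gamma0_pos)) K) (suGroupModel 2) 𝔠 k h ∩
        AlphaInputsT3AC.large67Set F 𝔠 γ hγ hγ1 K k h)
  have hC : IsClosed C := AlphaInputsT3AC.isClosed_adaptedCoreL (𝔠 := 𝔠) (hγ1 := hγ1) hk hh
  -- the level-`k` average of record PATCHED to `1` off the level-`k` cone (continuous on the core)
  let patch : GaugeField (F.P K) 0 (Matrix.specialUnitaryGroup (Fin 2) ℂ) → GaugeField (F.P K) k (Matrix.specialUnitaryGroup (Fin 2) ℂ) :=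
    fun U b => if b ∈ AlphaInputsT3AC.readBondsT3 F 𝔠 γ hγ hγ1 K k h k then
      Averaging.iter (fun i => BlockAveraging.blockAvg (P := F.P K) (j := i) ℰp) k U b else 1
  have hpatch : ContinuousOn patch C := by
    refine continuousOn_pi.2 fun b => ?_
    by_cases hb : b ∈ AlphaInputsT3AC.readBondsT3 F 𝔠 γ hγ hγ1 K k h k
    · simp only [patch, if_pos hb]
      exact (AlphaInputsT3AC.continuousOn_iter_readBond (𝔠 := 𝔠) (hγ1 := hγ1) hk h le_rfl hb).mono fun U hU => hU.1
    · simp only [patch, if_neg hb]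
      exact continuousOn_const
  let g : GaugeField (F.P K) 0 (Matrix.specialUnitaryGroup (Fin 2) ℂ) →
      GaugeField (F.P K) k (Matrix.specialUnitaryGroup (Fin 2) ℂ) × GaugeField (F.P K) 0 (Matrix.specialUnitaryGroup (Fin 2) ℂ) :=
    fun U => (patch U, U)
  have hg : ContinuousOn g C := hpatch.prodMk continuousOn_id
  let π : GaugeField (F.P K) k (Matrix.specialUnitaryGroup (Fin 2) ℂ) →
      GaugeField (F.P K) k (Matrix.specialUnitaryGroup (Fin 2) ℂ) × GaugeField (F.P K) 0 (Matrix.specialUnitaryGroup (Fin 2) ℂ) :=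
    fun W => (W, 1)
  have hπ : Measurable π := measurable_id.prodMk measurable_const
  let Sm : Set (GaugeField (F.P K) k (Matrix.specialUnitaryGroup (Fin 2) ℂ)) :=
    {W | ChargedT3 F γ 𝔠.b₀ 𝔠.p₀ (avgWindowFactor F.L) K 𝔠.lane.carrier.M₁
      (rcolOf (T3Scales F γ hγ (hγ1.trans (sq_min_one_le _ 𝔠.gamma0_pos)) K) 𝔠.lane.carrier) k h W}
  let Bk : Set (PBond (F.P K) k) := bondsIn k (Omega 𝔠.lane.carrier.M₁
      (rcolOf (T3Scales F γ hγ (hγ1.trans (sq_min_one_le _ 𝔠.gamma0_pos)) K) 𝔠.lane.carrier) k h k)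
  let D : Set (GaugeField (F.P K) 0 (Matrix.specialUnitaryGroup (Fin 2) ℂ)) :=
    AlphaInputsT3AC.localSmallT3 F 𝔠 γ hγ hγ1 K k h ∩ AlphaInputsT3AC.reg68LevelsSet F 𝔠 γ hγ hγ1 K k h
  let R : Set ((GaugeField (F.P K) k (Matrix.specialUnitaryGroup (Fin 2) ℂ) × GaugeField (F.P K) 0 (Matrix.specialUnitaryGroup (Fin 2) ℂ)) ×
      (GaugeField (F.P K) k (Matrix.specialUnitaryGroup (Fin 2) ℂ) × GaugeField (F.P K) 0 (Matrix.specialUnitaryGroup (Fin 2) ℂ))) :=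
    {p | p.2.1 ∈ Sm → (∀ b ∈ Bk, p.1.1 b = p.2.1 b) ∧ p.1.2 ∈ D}
  have hcoordk : ∀ b : PBond (F.P K) k, Continuous fun V : GaugeField (F.P K) k (Matrix.specialUnitaryGroup (Fin 2) ℂ) => V b :=
    fun b => continuous_apply b
  have hR : IsClosed R := by
    have hset : R = {p | p.2.1 ∈ Sm}ᶜ ∪ ((⋂ b ∈ Bk, {p | p.1.1 b = p.2.1 b}) ∩ {p | p.1.2 ∈ D}) := by
      ext p
      simp only [R, mem_setOf_eq, mem_union, mem_compl_iff, mem_inter_iff, mem_iInter]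
      by_cases hp : p.2.1 ∈ Sm
      · simp only [hp, forall_true_left, not_true_eq_false, false_or]
      · simp only [hp, IsEmpty.forall_iff, not_false_eq_true, true_or]
    rw [hset]
    refine IsClosed.union ?_ (IsClosed.inter (isClosed_biInter fun b _ => ?_) ?_)
    · exact ((AlphaInputsT3AC.isOpen_chargedT3 (𝔠 := 𝔠) (hγ1 := hγ1) k h).preimage (continuous_fst.comp continuous_snd)).isClosed_compl
    · exact isClosed_eq ((hcoordk b).comp (continuous_fst.comp continuous_fst)) ((hcoordk b).comp (continuous_fst.comp continuous_snd))
    · exact (AlphaInputsT3AC.isClosed_localSmallT3_inter_reg68LevelsSet (𝔠 := 𝔠) (hγ1 := hγ1) hk h).preimage (continuous_snd.comp continuous_fst)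
  -- the bonds of `Ω_k(h)` are read bonds, so the patch does not touch them
  have hBk : ∀ b ∈ Bk, ∀ U, patch U b = Averaging.iter (fun i => BlockAveraging.blockAvg (P := F.P K) (j := i) ℰp) k U b :=
    fun b hb U => if_pos (AlphaInputsT3AC.mem_readBondsT3_top (𝔠 := 𝔠) (hγ1 := hγ1) hb)
  -- the admissible sets of the selection ARE the localised adapted classes
  have hadm : ∀ W, {U | U ∈ C ∧ (g U, π W) ∈ R} = AlphaInputsT3AC.adaptedClassT3L F 𝔠 γ hγ hγ1 K k h W := by
    intro W
    ext U
    simp only [C, g, π, R, Sm, Bk, D, AlphaInputsT3AC.adaptedClassT3L, AlphaInputsT3AC.top42Set, mem_setOf_eq, mem_inter_iff]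
    constructor
    · rintro ⟨⟨hN, hReg, hL⟩, hrel⟩
      refine ⟨hN, hReg, hL, fun hc => ⟨fun b hb => ?_, (hrel hc).2.2⟩⟩
      rw [← hBk b hb U]; exact (hrel hc).1 b hb
    · rintro ⟨hN, hReg, hL, hrel⟩
      refine ⟨⟨hN, hReg, hL⟩, fun hc => ⟨fun b hb => ?_, hN, (hrel hc).2⟩⟩
      rw [hBk b hb U]; exact (hrel hc).1 b hb
  obtain ⟨⟨f, hfm, hfin, hfout⟩, hex⟩ := exists_measurable_argmin_closedClass hπ hC hg hR AlphaInputsT3AC.continuous_wilsonAction4_su2 1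
  simp only [hadm] at hfin hfout hex
  exact ⟨⟨f, hfm, hfin, hfout⟩, hex⟩

/-! ## §2 Membership ⇒ the rows' texts -/

/-- **MEMBERSHIP ⇒ ROW `h68`**: a member of `𝒞_L(k, h, W)`, `k ≤ K`, `h` admissible, satisfies the v3 row `h68`'s text (`regClassC ⊆ regClass`, g0's `h68_of_regLift`).
[cite: Balaban1985UV3, (68) p.273] -/
theorem AlphaInputsT3AC.h68_of_mem_adaptedClassT3L {k : ℕ} (hk : k ≤ K) {h : Hist (F.P K) k}
    (hh : Hist.Admissible 𝔠.lane.carrier.M₁ (rcolOf (T3Scales F γ hγ (hγ1.trans (sq_min_one_le _ 𝔠.gamma0_pos)) K) 𝔠.lane.carrier) k h)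
    {W : GaugeField (F.P K) k (Matrix.specialUnitaryGroup (Fin 2) ℂ)} {U : GaugeField (F.P K) 0 (Matrix.specialUnitaryGroup (Fin 2) ℂ)}
    (hU : U ∈ AlphaInputsT3AC.adaptedClassT3L F 𝔠 γ hγ hγ1 K k h W) :
    ∀ e ∈ Hist.disc h,
      pdevOn (loK F.L e.1 (codeZ e)) (plaqHiK F.L e.1 (codeZ e) e.2.2.1 e.2.2.2)
          (liftCfg (S := T3Scales F γ hγ (hγ1.trans (sq_min_one_le _ 𝔠.gamma0_pos)) K) (suGroupModel 2) U) <
        𝔠.C68 * ((T3Scales F γ hγ (hγ1.trans (sq_min_one_le _ 𝔠.gamma0_pos)) K).gk e.1 *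
          pFun 𝔠.lane.carrier.b₀ 𝔠.lane.carrier.p₀ ((T3Scales F γ hγ (hγ1.trans (sq_min_one_le _ 𝔠.gamma0_pos)) K).gk e.1)) *
          (((F.L : ℝ) ^ e.1)⁻¹) ^ 2 :=
  AlphaInputsT3AC.h68_of_regLift (S := T3Scales F γ hγ (hγ1.trans (sq_min_one_le _ 𝔠.gamma0_pos)) K) hk hh U
    (regClassC_subset_regClass (S := T3Scales F γ hγ (hγ1.trans (sq_min_one_le _ 𝔠.gamma0_pos)) K) (suGroupModel 2) 𝔠 hk h hU.2.1)

/-- **MEMBERSHIP ⇒ ROW `hLF67`**: a member of `𝒞_L(k, h, W)` satisfies the v3 row `hLF67`'s text (it is the (67)-largeness conjunct). [cite: Balaban1985UV3, (67) p.273] -/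
theorem AlphaInputsT3AC.hLF67_of_mem_adaptedClassT3L {k : ℕ} {h : Hist (F.P K) k}
    {W : GaugeField (F.P K) k (Matrix.specialUnitaryGroup (Fin 2) ℂ)} {U : GaugeField (F.P K) 0 (Matrix.specialUnitaryGroup (Fin 2) ℂ)}
    (hU : U ∈ AlphaInputsT3AC.adaptedClassT3L F 𝔠 γ hγ hγ1 K k h W) :
    ∀ e ∈ Hist.disc h,
      (T3Scales F γ hγ (hγ1.trans (sq_min_one_le _ 𝔠.gamma0_pos)) K).gk e.1 *
          pFun 𝔠.lane.carrier.b₀ 𝔠.lane.carrier.p₀ ((T3Scales F γ hγ (hγ1.trans (sq_min_one_le _ 𝔠.gamma0_pos)) K).gk e.1) ≤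
        ‖((hol (avgIter F.L (liftCfg (S := T3Scales F γ hγ (hγ1.trans (sq_min_one_le _ 𝔠.gamma0_pos)) K) (suGroupModel 2) U) e.1)
            (codeZ e) (plaqWord e.2.2.1 e.2.2.2) : (Matrix (Fin (suGroupModel 2).N) (Fin (suGroupModel 2).N) ℂ)ˣ) :
            Matrix (Fin (suGroupModel 2).N) (Fin (suGroupModel 2).N) ℂ) - 1‖ :=
  hU.2.2.1

/-- **MEMBERSHIP ⇒ ROW r2** for a charged datum: the top constraint (42) on the bonds of `Ω_k(h)`. [cite: Balaban1985UV3, (42) p.266] -/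
theorem AlphaInputsT3AC.constraint42_of_mem_adaptedClassT3L {k : ℕ} {h : Hist (F.P K) k}
    {W : GaugeField (F.P K) k (Matrix.specialUnitaryGroup (Fin 2) ℂ)} {U : GaugeField (F.P K) 0 (Matrix.specialUnitaryGroup (Fin 2) ℂ)}
    (hU : U ∈ AlphaInputsT3AC.adaptedClassT3L F 𝔠 γ hγ hγ1 K k h W)
    (hc : ChargedT3 F γ 𝔠.b₀ 𝔠.p₀ (avgWindowFactor F.L) K 𝔠.lane.carrier.M₁
      (rcolOf (T3Scales F γ hγ (hγ1.trans (sq_min_one_le _ 𝔠.gamma0_pos)) K) 𝔠.lane.carrier) k h W)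
    (b : PBond (F.P K) k)
    (hb : b ∈ bondsIn k (Omega 𝔠.lane.carrier.M₁
      (rcolOf (T3Scales F γ hγ (hγ1.trans (sq_min_one_le _ 𝔠.gamma0_pos)) K) 𝔠.lane.carrier) k h k)) :
    Averaging.iter (fun i => BlockAveraging.blockAvg (P := F.P K) (j := i) ℰp) k U b = W b :=
  (hU.2.2.2 hc).1 b hb

/-- **MEMBERSHIP ⇒ ROW r3** for a charged datum: the multi-level regularity (68). [cite: Balaban1985UV3, (68) p.273] -/
theorem AlphaInputsT3AC.regularity68Levels_of_mem_adaptedClassT3L {k : ℕ} {h : Hist (F.P K) k}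
    {W : GaugeField (F.P K) k (Matrix.specialUnitaryGroup (Fin 2) ℂ)} {U : GaugeField (F.P K) 0 (Matrix.specialUnitaryGroup (Fin 2) ℂ)}
    (hU : U ∈ AlphaInputsT3AC.adaptedClassT3L F 𝔠 γ hγ hγ1 K k h W)
    (hc : ChargedT3 F γ 𝔠.b₀ 𝔠.p₀ (avgWindowFactor F.L) K 𝔠.lane.carrier.M₁
      (rcolOf (T3Scales F γ hγ (hγ1.trans (sq_min_one_le _ 𝔠.gamma0_pos)) K) 𝔠.lane.carrier) k h W)
    (i : ℕ) (hi : i ≤ k) (s : ℕ) (hs : s ≤ i) (q : Plaq (F.P K) s)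
    (hq : q ∈ plaqsIn s (lam42 (Omega 𝔠.lane.carrier.M₁
      (rcolOf (T3Scales F γ hγ (hγ1.trans (sq_min_one_le _ 𝔠.gamma0_pos)) K) 𝔠.lane.carrier) k h) k i)) :
    GaugeGroup.dist1 (GaugeField.plaqHol
        (Averaging.iter (fun l => BlockAveraging.blockAvg (P := F.P K) (j := l) ℰp) s U) q) ≤
      𝔠.C68 * θBal F.L γ 𝔠.b₀ 𝔠.p₀ (K - i) * (((F.L : ℝ) ^ (i - s))⁻¹) ^ 2 :=
  (hU.2.2.2 hc).2 i hi s hs q hq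

end T3

end Summit.QuantumFields.YangMills.Theorems

end
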